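import Literature.AlgebraicGeometry.Motives.BaseChange
import Literature.AlgebraicGeometry.Motives.AlgPointsProductProofs
import HarnessLib

/-!
# The strong topology is compatible with base change (proof file for `Motives/BaseChange`)

Sibling proof file of `Literature/AlgebraicGeometry/Motives/BaseChange.lean`. That file vendors as
a *named fact* `Literature.AlgebraicGeometry.Motives.AlgPoints.isHomeomorph_baseChangeEquiv`: for a
`k`-scheme `X`, a field homomorphism `σ : k →+* L` and a Hausdorff topological field `L`, the
bijection `AlgPoints.baseChangeEquiv σ X : X(L) ≃ X_σ(L)` (where `L` is a `k`-algebra through `σ`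
and `X_σ = X ×_{Spec k, σ} Spec L`) is a homeomorphism for the strong topologies
`AlgPoints.instTopologicalSpace`. This file **discharges that fact**
(`Literature.AlgebraicGeometry.Motives.AlgPoints.isHomeomorph_baseChangeEquiv_holds`) from Mathlib,
the accepted `AlgPoints` API and the device of `Motives/AlgPointsProductProofs.lean` ("families
through `Spec C(S, L)` are continuous", `AlgPoints.continuous_of_family`, with the interpolating
morphisms `AlgPoints.familyMap`).

The printed source is B. Conrad, *Weil and Grothendieck approaches to adelic points*, Enseign.
Math. (2) **58** (2012), 61–97: Prop. 2.1 (for affine `X` of finite type over a topological ring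
`R`, the topology on `X(R)` is functorial in `X` and compatible with the formation of fibre
products) and Prop. 3.1 (uniqueness of the glued topology for schemes locally of finite type over
a suitable local topological ring, subject to functoriality, open/closed immersions and
compatibility with fibre products) — the same source and locators as for the sibling discharge
`AlgPoints.isHomeomorph_prodEquiv_holds`; `X_σ(L) = X(L)` is the fibre product `X ×ₖ Spec L`
evaluated on `L`-points. The Lean fact concerns Mumford's intrinsic description of the topology
(*Red Book* I §10) for arbitrary `k`-schemes; as for products, the finite-type hypotheses of the
source play no role and are not assumed — only continuity of `+`, `*`, `⁻¹` and closedness of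
`{0}` in `L` are used.

## Proof

* `X_σ(L) → X(L)` (the inverse, `Q ↦ Q ≫ π` on underlying morphisms,
  `AlgPoints.baseChangeEquiv_symm_apply_left`) is continuous because the underlying point and the
  values of regular functions of an `L`-point depend only on its underlying morphism
  `Spec L ⟶ X` (`pt_eq_of_left_eq_comp`, `eval_eq_of_left_eq_comp`), so the preimage of the
  sub-basic set `{P ∈ U(L) | f(P) ∈ V}` is `{Q ∈ π⁻¹U (L) | (π^* f)(Q) ∈ V}`
  (`preimage_baseChangeEquiv_symm_basicSet`).
* `X(L) → X_σ(L)`: on `S = U(L)` for an affine open `U ⊆ X`, the inclusion is a continuous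
  family, interpolated by `familyMap : Spec C(S, L) ⟶ U ⊆ X` (a `k`-morphism whose structure map
  consists of the constants `σ(c)`, `AlgPoints.familyMap_over`); pairing it with the constants
  `Spec C(S, L) ⟶ Spec L` gives `Spec C(S, L) ⟶ X ×_k Spec L = X_σ` interpolating
  `baseChangeEquiv|_S`, which is therefore continuous (`AlgPoints.continuous_of_family`);
  the `U(L)` cover `X(L)` by open sets (`AlgPoints.isOpen_setOf_pt_mem`).

## References

* B. Conrad, *Weil and Grothendieck approaches to adelic points*, Enseign. Math. (2) **58**
  (2012), 61–97, doi:10.4171/lem/58-1-3, Prop. 2.1 (§2), Prop. 3.1 (§3). [ConradAdelicPoints2012]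
* D. Mumford, *The Red Book of Varieties and Schemes*, I §10.
* R. Hartshorne, *Algebraic Geometry*, II Ex. 2.7, II Thm. 3.3.
-/

universe u

open CategoryTheory AlgebraicGeometry Limits Topology

noncomputable section

namespace Literature.AlgebraicGeometry.Motives

namespace AlgPoints

/-! ### Points and values depend only on the underlying morphism `Spec L ⟶ X` -/

section LeftOnly

variable {k : Type u} [Field k] {k' : Type u} [Field k'] {L : Type u} [Field L] [Algebra k L]
  [Algebra k' L] {X : SchemeOver k} {Z : SchemeOver k'}

/-- If the underlying morphism of an `L`-point `P` of the `k`-scheme `X` factors as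
`Spec L ⟶ Z ⟶ X` through an `L`-point `Q` of a `k'`-scheme `Z` and a morphism of schemes
`g : Z ⟶ X`, then the point of `X` underlying `P` is the image under `g` of the point underlying
`Q` (Hartshorne II Ex. 2.7: an `L`-point is a point with a residue-field embedding). [folklore] -/
theorem pt_eq_of_left_eq_comp (P : AlgPoints X L) (Q : AlgPoints Z L) (g : Z.left ⟶ X.left)
    (h : P.left = Q.left ≫ g) : P.pt = g.base Q.pt := by
  change P.left.base (IsLocalRing.closedPoint L) = g.base (Q.left.base (IsLocalRing.closedPoint L))
  rw [h]
  rfl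

/-- In the situation of `pt_eq_of_left_eq_comp`, the value at `P` of a regular function `f` on
`U ⊆ X` is the value at `Q` of the pulled-back function `g^* f` on `g⁻¹U` (both are the pull-back
of `f` to `Γ(Spec L, 𝒪) = L`, `AlgPoints.eval_eq_appLE`, and pull-back is functorial, Mathlib
`Scheme.Hom.appLE_comp_appLE`). [folklore] -/
theorem eval_eq_of_left_eq_comp (P : AlgPoints X L) (Q : AlgPoints Z L) (g : Z.left ⟶ X.left)
    (h : P.left = Q.left ≫ g) (U : X.left.Opens) (hP : P.pt ∈ U) (hQ : Q.pt ∈ g ⁻¹ᵁ U)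
    (f : Γ(X.left, U)) :
    P.eval U hP f = Q.eval (g ⁻¹ᵁ U) hQ (g.app U f) := by
  rw [eval_eq_appLE, eval_eq_appLE]
  have key : ∀ (p : Spec (.of L) ⟶ X.left) (e : (⊤ : (Spec (.of L)).Opens) ≤ p ⁻¹ᵁ U),
      p = Q.left ≫ g →
        (Scheme.ΓSpecIso (.of L)).hom (p.appLE U ⊤ e f) =
          (Scheme.ΓSpecIso (.of L)).hom
            (Q.left.appLE (g ⁻¹ᵁ U) ⊤ (Q.preimage_eq_top hQ).ge (g.app U f)) := by
    rintro p e rfl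
    rw [Scheme.Hom.app_eq_appLE g,
      ← CategoryTheory.comp_apply (g.appLE U (g ⁻¹ᵁ U) le_rfl) (Q.left.appLE (g ⁻¹ᵁ U) ⊤ _),
      Scheme.Hom.appLE_comp_appLE]
    rfl
  exact key P.left _ h

end LeftOnly

/-! ### Base change -/

section BaseChange

variable {k L : Type u} [Field k] [Field L] (σ : k →+* L) (X : SchemeOver k)

/-- The inverse bijection `X_σ(L) → X(L)` pulls the sub-basic open set `{P ∈ U(L) | f(P) ∈ V}`
back to the sub-basic open set `{Q ∈ (π⁻¹U)(L) | (π^* f)(Q) ∈ V}` of `X_σ(L)`, `π : X_σ ⟶ X` the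
projection (Mumford, *Red Book*, I §10; Hartshorne II Ex. 2.7). [folklore] -/
theorem preimage_baseChangeEquiv_symm_basicSet [TopologicalSpace L] (U : X.left.Opens)
    (f : Γ(X.left, U)) (V : Set L) :
    (fun Q ↦ (letI := σ.toAlgebra; (baseChangeEquiv σ X).symm Q)) ⁻¹'
        (letI := σ.toAlgebra; (basicSet U f V : Set (AlgPoints X L))) =
      basicSet ((baseChangeHomFst σ X) ⁻¹ᵁ U) ((baseChangeHomFst σ X).app U f) V := by
  letI := σ.toAlgebra
  ext Q
  simp only [Set.mem_preimage, basicSet, Set.mem_setOf_eq]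
  have hl : ((baseChangeEquiv σ X).symm Q).left = Q.left ≫ baseChangeHomFst σ X :=
    baseChangeEquiv_symm_apply_left σ X Q
  have hpt := pt_eq_of_left_eq_comp _ Q _ hl
  constructor
  · rintro ⟨h, hV⟩
    have hQ : Q.pt ∈ (baseChangeHomFst σ X) ⁻¹ᵁ U := by
      change (baseChangeHomFst σ X).base Q.pt ∈ U
      rwa [← hpt]
    exact ⟨hQ, by rwa [← eval_eq_of_left_eq_comp _ Q _ hl U h hQ f]⟩
  · rintro ⟨hQ, hV⟩
    have h : ((baseChangeEquiv σ X).symm Q).pt ∈ U := by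
      rw [hpt]
      exact hQ
    exact ⟨h, by rwa [eval_eq_of_left_eq_comp _ Q _ hl U h hQ f]⟩

/-- `X_σ(L) → X(L)`, `Q ↦ Q ≫ π`, is continuous for the strong topologies (any
`[TopologicalSpace L]`): regular functions on `X` pull back to regular functions on `X_σ`
(Mumford, *Red Book*, I §10). [folklore] -/
theorem continuous_baseChangeEquiv_symm [TopologicalSpace L] :
    Continuous fun Q ↦ (letI := σ.toAlgebra; (baseChangeEquiv σ X).symm Q) := by
  letI := σ.toAlgebra
  refine continuous_generateFrom_iff.mpr ?_
  rintro _ ⟨U, f, V, hV, rfl⟩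
  rw [preimage_baseChangeEquiv_symm_basicSet]
  exact isOpen_basicSet _ _ hV

/-- The underlying morphism of `baseChangeEquiv σ X P ∈ X_σ(L)` followed by the second projection
`X_σ = X ×ₖ Spec L ⟶ Spec L` is the identity of `Spec L` (it is a point over `L`). [folklore] -/
theorem baseChangeEquiv_apply_left_comp_snd (P : letI := σ.toAlgebra; AlgPoints X L) :
    (letI := σ.toAlgebra; (baseChangeEquiv σ X P).left) ≫
        pullback.snd X.hom (Spec.map (CommRingCat.ofHom σ)) =
      Spec.map (CommRingCat.ofHom (algebraMap L L)) := by
  letI := σ.toAlgebra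
  exact Over.w (baseChangeEquiv σ X P)

variable [TopologicalSpace L] [IsTopologicalDivisionRing L] [T1Space L]

/-- `baseChangeEquiv σ X : X(L) → X_σ(L)` is continuous on `U(L)` for an affine open `U ⊆ X`: the
inclusion `S = U(L) ⊆ X(L)` is a continuous family, interpolated by the `k`-morphism
`familyMap : Spec C(S, L) ⟶ X` whose structure map consists of the constants `σ(c)`
(`AlgPoints.familyMap_over`); pairing it with the constants `Spec C(S, L) ⟶ Spec L` gives
`Spec C(S, L) ⟶ X ×ₖ Spec L = X_σ` interpolating `baseChangeEquiv|_S`; conclude by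
`AlgPoints.continuous_of_family` (Conrad, *loc. cit.*, Prop. 2.1 / Prop. 3.1: compatibility of
the topology with fibre products). [folklore] -/
theorem continuousOn_baseChangeEquiv {U : X.left.Opens} (hU : IsAffineOpen U) :
    ContinuousOn (fun P ↦ (letI := σ.toAlgebra; baseChangeEquiv σ X P))
      (letI := σ.toAlgebra; {P : AlgPoints X L | P.pt ∈ U}) := by
  letI := σ.toAlgebra
  rw [continuousOn_iff_continuous_restrict]
  -- the parameter space and the family
  set S := {P : AlgPoints X L // P.pt ∈ U} with hS
  let ι : S → AlgPoints X L := fun s ↦ s.1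
  have hι : Continuous ι := continuous_subtype_val
  have hιU : ∀ s, (ι s).pt ∈ U := fun s ↦ s.2
  let f₁ := familyMap ι hι U hιU hU
  let f₂ : Spec (.of C(S, L)) ⟶ Spec (.of L) :=
    Spec.map (CommRingCat.ofHom (algebraMap L C(S, L)))
  -- the family is over `k`, with structure map the constants `σ c`
  have hover : f₁ ≫ X.hom = f₂ ≫ Spec.map (CommRingCat.ofHom σ) := by
    obtain ⟨ψ, hψ⟩ := Spec.map_surjective (f₁ ≫ X.hom)
    rw [← hψ, ← Spec.map_comp]
    congr 1
    ext c s
    rw [familyMap_over ι hι U hιU hU ψ hψ c s]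
    change algebraMap k L c = (algebraMap L C(S, L) (σ c)) s
    rw [_root_.algebraMap_apply, smul_eq_mul, mul_one]
    rfl
  -- the interpolating morphism `Spec C(S, L) ⟶ X ×ₖ Spec L = X_σ`
  let τ : Spec (.of C(S, L)) ⟶ ((baseChangeHom σ).obj X).left := pullback.lift f₁ f₂ hover
  refine continuous_of_family (k := L) τ _ fun s ↦ ?_
  change Spec.map (CommRingCat.ofHom (evalAt L s)) ≫ pullback.lift f₁ f₂ hover =
    (baseChangeEquiv σ X (ι s)).left
  apply pullback.hom_ext
  · rw [Category.assoc, pullback.lift_fst]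
    change _ = (baseChangeEquiv σ X (ι s)).left ≫ baseChangeHomFst σ X
    rw [baseChangeEquiv_apply_left_comp_fst]
    exact specMap_evalAt_familyMap ι hι U hιU hU s
  · rw [Category.assoc, pullback.lift_snd]
    change Spec.map _ ≫ f₂ = (baseChangeEquiv σ X (ι s)).left ≫ ((baseChangeHom σ).obj X).hom
    rw [Over.w, ← Spec.map_comp]
    change _ = Spec.map (CommRingCat.ofHom (algebraMap L L))
    congr 1  -- `ev_s ∘ (constants) = id = algebraMap L L`, closed by `rfl`

/-- `baseChangeEquiv σ X : X(L) → X_σ(L)` is continuous: the `U(L)` for affine opens `U ⊆ X` form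
an open cover of `X(L)` (`AlgPoints.isOpen_setOf_pt_mem`) on which it is continuous
(Conrad, *loc. cit.*, Prop. 3.1). [folklore] -/
theorem continuous_baseChangeEquiv :
    Continuous fun P ↦ (letI := σ.toAlgebra; baseChangeEquiv σ X P) := by
  letI := σ.toAlgebra
  rw [continuous_iff_continuousAt]
  intro P
  obtain ⟨_, ⟨U, hU, rfl⟩, hPU, -⟩ := X.left.isBasis_affineOpens.exists_subset_of_mem_open
    (Set.mem_univ P.pt) isOpen_univ
  exact (continuousOn_baseChangeEquiv σ X hU).continuousAt
    (IsOpen.mem_nhds (isOpen_setOf_pt_mem U) hPU)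

end BaseChange

section Discharge

variable {k L : Type u} [Field k] [Field L] (σ : k →+* L) (X : SchemeOver k)

/-- **Discharge of `isHomeomorph_baseChangeEquiv`.** For a field homomorphism `σ : k →+* L`, a
`k`-scheme `X` and a Hausdorff topological field structure on `L`, the bijection
`baseChangeEquiv σ X : X(L) ≃ X_σ(L)` (`L` a `k`-algebra through `σ`, `X_σ = X ×_{Spec k, σ} Spec L`)
is a homeomorphism for the strong topologies (Conrad, *Weil and Grothendieck approaches to adelic
points*, Enseign. Math. 58 (2012), Prop. 2.1 and Prop. 3.1: functoriality and compatibility with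
fibre products of the topology on points; Mumford, *Red Book* I §10). Only
continuity of `+`, `*`, `⁻¹` and closedness of `{0}` in `L` are used; the finite-type hypotheses
of the source are not needed. [cite: ConradAdelicPoints2012, Prop. 2.1 and Prop. 3.1] -/
theorem isHomeomorph_baseChangeEquiv_holds : isHomeomorph_baseChangeEquiv σ X := by
  intro _ _ _
  letI := σ.toAlgebra
  exact (Homeomorph.mk (baseChangeEquiv σ X) (continuous_baseChangeEquiv σ X)
    (continuous_baseChangeEquiv_symm σ X)).isHomeomorph

end Discharge

end AlgPoints

end Literature.AlgebraicGeometry.Motives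

end
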